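import Summits.Ventures.PercRepro.C025ProfileParallel
import Summits.Ventures.PercRepro.C025ProfileLoop
import Summits.Ventures.PercRepro.C025ProfileOne

/-!
# C-032 «PROFILE (Π)» — the row `q = 1` for EVERY finite matroid (night-3 g6)

`profileIneq_one_all (M) [M.Finite] (u) (hu : 1 ≤ u) : Profile.ProfileIneq M 1 u`, i.e. for every finite matroid
and every level `u ≥ 1`

  `#{S ⊆ E : ρ(S) = u} ≥ Σ_{B ⊆ E, ρ(B) = 1, ρ(E∖B) ≥ u} C(ρ(E∖B)+1, u) / (ρ(E∖B)+1)`

(the `q = 1` instance of `PercRepro.C025Profile`). Induction on `|E|`: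
* a loop `ℓ`: `profileIneq_of_delete_isLoop` (`C025ProfileLoop`) lifts `(Π_{1,u})` from `M ＼ {ℓ}`;
* a parallel pair `e ∥ f` in a loopless `M`: `profileIneq_one_of_delete_parallel` (`C025ProfileParallel`) lifts
  `(Π_{1,u})` from `M ＼ {e}`;
* otherwise `M` is simple (`simple_of_no_loop_no_parallel`) and `profileIneq_one_of_simple` (`C025ProfileOne`) applies.
-/

open scoped Matroid

namespace PercRepro

open Set Finset ThmH

variable {α : Type} [DecidableEq α]

omit [DecidableEq α] in
/-- A loopless matroid without parallel pairs is simple: every set of at most two elements is independent. -/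
theorem simple_of_no_loop_no_parallel {M : Matroid α} (hl : ∀ x ∈ M.E, M.IsNonloop x)
    (hpar : ∀ e f, f ∈ M.E → f ≠ e → e ∉ M.closure {f}) :
    ∀ T ⊆ M.E, T.encard ≤ 2 → M.Indep T := by
  intro T hT hcard
  have hfin : T.encard ≠ ⊤ := ne_top_of_le_ne_top (ENat.coe_ne_top 2) hcard
  obtain ⟨n, hn⟩ := ENat.ne_top_iff_exists.1 hfin
  have hn2 : n ≤ 2 := by rw [← hn] at hcard; exact_mod_cast hcard
  interval_cases n
  · rw [Set.encard_eq_zero.1 hn.symm]; exact M.empty_indep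
  · obtain ⟨x, rfl⟩ := Set.encard_eq_one.1 hn.symm
    exact M.indep_singleton.2 (hl x (hT (Set.mem_singleton x)))
  · obtain ⟨x, y, hxy, rfl⟩ := Set.encard_eq_two.1 hn.symm
    have hxE : x ∈ M.E := hT (Set.mem_insert x _)
    have hyE : y ∈ M.E := hT (Set.mem_insert_of_mem x (Set.mem_singleton y))
    have hy : M.Indep {y} := M.indep_singleton.2 (hl y hyE)
    rw [hy.insert_indep_iff_of_notMem (by simpa using hxy)]
    exact ⟨hxE, hpar x y hyE (Ne.symm hxy)⟩

/-- **The row `q = 1` of C-032 for every finite matroid**: `(Π_{1,u})` for all `u ≥ 1`. -/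
theorem profileIneq_one_all (M : Matroid α) [M.Finite] (u : ℕ) (hu : 1 ≤ u) : Profile.ProfileIneq M 1 u := by
  obtain ⟨u', rfl⟩ : ∃ u', u = u' + 1 := ⟨u - 1, by omega⟩
  suffices h : ∀ n : ℕ, ∀ (N : Matroid α) [N.Finite], (gr N).card = n → Profile.ProfileIneq N 1 (u' + 1) from
    h _ M rfl
  intro n
  induction n using Nat.strong_induction_on with
  | _ n ih =>
  intro N _ hN
  by_cases hloop : ∃ ℓ, N.IsLoop ℓ
  · obtain ⟨ℓ, hℓ⟩ := hloop
    have hℓE : ℓ ∈ gr N := by rw [← Finset.mem_coe, coe_gr]; exact hℓ.mem_ground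
    apply profileIneq_of_delete_isLoop hℓ
    apply ih ((gr N).erase ℓ).card _ (N ＼ ({ℓ} : Set α)) (by rw [gr_delete_singleton''])
    rw [← hN]; exact Finset.card_erase_lt_of_mem hℓE
  · have hl : ∀ x ∈ N.E, N.IsNonloop x := fun x hx => N.isNonloop_of_not_isLoop hx (fun h => hloop ⟨x, h⟩)
    by_cases hpar : ∃ e f, f ∈ N.E ∧ f ≠ e ∧ e ∈ N.closure {f}
    · obtain ⟨e, f, hfE, hfe, hef⟩ := hpar
      have heE : e ∈ gr N := by rw [← Finset.mem_coe, coe_gr]; exact N.closure_subset_ground _ hef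
      apply profileIneq_one_of_delete_parallel hl hfE hfe hef u'
      apply ih ((gr N).erase e).card _ (N ＼ ({e} : Set α)) (by rw [gr_delete_singleton''])
      rw [← hN]; exact Finset.card_erase_lt_of_mem heE
    · push Not at hpar
      exact profileIneq_one_of_simple (simple_of_no_loop_no_parallel hl hpar) (u' + 1) (by omega)

/-- The `q = 1` instance of `C025Profile` exactly as the row is stated there (`q < u`). -/
theorem c025Profile_row_one (M : Matroid α) [M.Finite] (u : ℕ) (hqu : 1 < u) : Profile.ProfileIneq M 1 u :=
  profileIneq_one_all M u hqu.le

end PercRepro
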